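import Summits.AnomalousDissipation.AnomalousDissipation.Cruxes.GalerkinFloor.Lines.birth
import Literature.Analysis.FluidPDE.GalerkinFlow
import Literature.Analysis.FluidPDE.GalerkinInvariantMeasure
import Literature.Analysis.FluidPDE.NSGalerkinStationary
import Literature.Analysis.FluidPDE.NSHopfGalerkinExistence
import Literature.Analysis.FluidPDE.LongTimeAveragePeriodic
import Literature.Analysis.FluidPDE.LongTimeAverageSubadditive
import Literature.Dynamics.Ergodic.AuxiliaryFunctionDualityProofs
import Literature.Dynamics.Ergodic.KrylovBogolyubovSemiflow

/-!
# Stub-ideation k3 (FAMILY 3 — PROBE THE EXTREMES) — helper-lemma sketch for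
`stub_uniformGalerkinAnomaly` of crux `DecimationAxis.GalerkinFloor` (stmt-AnomalousDissipation-1582)

Elaboration-only sanity file (planner seat `sidea-stmt-AnomalousDissipation-1582-stub_uniformGa-3`):
every `theorem` below is a PROPOSED HELPER LEMMA, stated over the birth skeleton's transparent
vocabulary (`IsDesignerForce`, `IsCoeffTrajectory`, `coeffEnergy`, `coeffDissipation`, imported from
`Cruxes/GalerkinFloor/Lines/birth.lean`) and left `sorry`.  Nothing here is registered; the plan is
`STUB-IDEAS-stub_uniformGalerkinAnomaly-3.md` in the crux directory.

§A energy balance & the two currencies (orbit ⟷ invariant law), §B extremal witnesses at finite `(ν, K)`,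
§C autopsy / tightness (which variants are false and what any witness must look like),
§D first-order (in `ν`) transfer-deficit form for a single-shell designer force.
-/

noncomputable section

set_option linter.dupNamespace false
set_option linter.unusedVariables false

open Filter Set MeasureTheory Metric
open scoped Topology NNReal
open Literature.Analysis.FunctionSpaces.Torus Literature.Analysis.FluidPDE Literature.Analysis.FluidPDE.Torus

namespace Summit.AnomalousDissipation.AnomalousDissipation.Cruxes.GalerkinFloor.Birth

open Summit.AnomalousDissipation.AnomalousDissipation.Theses.DecimationAxis

/-- Lattice frequencies `ℤ³` (local notation). -/
local notation "ℤ³" => Fin 3 → ℤ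
/-- Fourier coefficient values `ℂ³` (local notation). -/
local notation "ℂ³" => EuclideanSpace ℂ (Fin 3)

/-! ## §A  Energy balance and the two currencies -/

/-- Injection rate (work of the force) `W(t) = Σ_{k∈S} Re⟨c_k(t), g_k⟩ = ∫⟪G, u(t)⟫`. -/
def coeffWork {S : Finset ℤ³} (g : ℤ³ → ℂ³) (c : ℝ → ↥S → ℂ³) : ℝ → ℝ :=
  fun t => ∑ k : ↥S, (inner ℂ (c t k) (g k)).re

/-- **A1 (dictionary).** The crux's trajectory notion IS the tree's `IsGalerkinODESolution` from `c 0`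
with force coefficients `g↾S` (definitional up to the `initial` field). -/
theorem isCoeffTrajectory_iff {S : Finset ℤ³} {ν : ℝ} {g : ℤ³ → ℂ³} {c : ℝ → ↥S → ℂ³} :
    IsCoeffTrajectory S ν g c ↔ IsGalerkinODESolution ν (fun k : ↥S => g k) (c 0) c := by
  sorry

/-- **A2 (energy identity, differential form).** `d/dt Σ‖c_k‖² = 2 (W − D)` within `[0, T]`
(`hasDerivWithinAt_energy` + the coefficient form of `sum_re_inner_galerkinField_self`). -/
theorem hasDerivWithinAt_coeffEnergy {S : Finset ℤ³} (hS : ∀ k ∈ S, -k ∈ S) {ν : ℝ} {g : ℤ³ → ℂ³}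
    (hg : IsConjSymm g) {c : ℝ → ↥S → ℂ³} (hc : IsCoeffTrajectory S ν g c) (T : ℝ) {t : ℝ}
    (ht : t ∈ Set.Icc (0 : ℝ) T) :
    HasDerivWithinAt (coeffEnergy c) (2 * (coeffWork g c t - coeffDissipation ν c t)) (Set.Icc 0 T) t := by
  sorry

/-- **A3 (absorbing ball, no mean mode).** On `S ∌ 0` (so `|k| ≥ 1` on `S`) every trajectory obeys
`Σ‖c_k(t)‖² ≤ max (Σ‖c_k(0)‖²) (Σ‖g_k‖² / (4π²ν)²)` for `t ≥ 0`
(adapt `energy_le_of_isGalerkinODESolution`, Theorems/MomentParity…KrylovBogoliubovA). -/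
theorem coeffEnergy_le_max {S : Finset ℤ³} (hS : ∀ k ∈ S, -k ∈ S) (h0 : (0 : ℤ³) ∉ S) {ν : ℝ}
    (hν : 0 < ν) {g : ℤ³ → ℂ³} (hg : IsConjSymm g) {c : ℝ → ↥S → ℂ³} (hc : IsCoeffTrajectory S ν g c)
    {t : ℝ} (ht : 0 ≤ t) :
    coeffEnergy c t ≤ max (coeffEnergy c 0) ((∑ k : ↥S, ‖g k‖ ^ 2) / (4 * Real.pi ^ 2 * ν) ^ 2) := by
  sorry

/-- **A4 (long-time balance).** Bounded energy ⇒ the boundary term `(En(T) − En(0))/(2T) → 0`, so the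
`liminf`- and `limsup`-means of dissipation and injection coincide. -/
theorem longTimeAvg_coeffDissipation_eq_coeffWork {S : Finset ℤ³} (hS : ∀ k ∈ S, -k ∈ S)
    (h0 : (0 : ℤ³) ∉ S) {ν : ℝ} (hν : 0 < ν) {g : ℤ³ → ℂ³} (hg : IsConjSymm g) {c : ℝ → ↥S → ℂ³}
    (hc : IsCoeffTrajectory S ν g c) :
    longTimeAvgInf (coeffDissipation ν c) = longTimeAvgInf (coeffWork g c) ∧
      longTimeAvgSup (coeffDissipation ν c) = longTimeAvgSup (coeffWork g c) := by
  sorry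

/-- **A5 (energy row: injection ≤ force × rms velocity).** Cauchy–Schwarz in `k` and Jensen in `t`:
`⟨W⟩⁺ ≤ ‖g‖_{ℓ²(S)} · √⟨En⟩⁺`. -/
theorem longTimeAvgSup_coeffWork_le {S : Finset ℤ³} (hS : ∀ k ∈ S, -k ∈ S) (h0 : (0 : ℤ³) ∉ S)
    {ν : ℝ} (hν : 0 < ν) {g : ℤ³ → ℂ³} (hg : IsConjSymm g) {c : ℝ → ↥S → ℂ³}
    (hc : IsCoeffTrajectory S ν g c) :
    longTimeAvgSup (coeffWork g c) ≤
      Real.sqrt (∑ k : ↥S, ‖g k‖ ^ 2) * Real.sqrt (longTimeAvgSup (coeffEnergy c)) := by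
  sorry

/-- **A6 (cone ⇒ window; S1 currency of the strategy census).** A `liminf`-mean floor for the single
observable `Φ_λ = D − λ·En` (`λ > 0`) gives BOTH clauses of the stub, with energy budget `‖g‖²/λ²`. -/
theorem window_of_cone {S : Finset ℤ³} (hS : ∀ k ∈ S, -k ∈ S) (h0 : (0 : ℤ³) ∉ S) {ν : ℝ} (hν : 0 < ν)
    {g : ℤ³ → ℂ³} (hg : IsConjSymm g) {c : ℝ → ↥S → ℂ³} (hc : IsCoeffTrajectory S ν g c)
    {lam δ : ℝ} (hlam : 0 < lam) (hδ : 0 < δ)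
    (hcone : δ ≤ longTimeAvgInf (fun t => coeffDissipation ν c t - lam * coeffEnergy c t)) :
    longTimeAvgSup (coeffEnergy c) ≤ (∑ k : ↥S, ‖g k‖ ^ 2) / lam ^ 2 ∧
      δ ≤ longTimeAvgInf (coeffDissipation ν c) := by
  sorry

/-- **A7 (law ⇒ orbit, `liminf` version).** An invariant Borel probability law of the level-`S` Galerkin
semiflow, carried by a compact subset of the phase space, with `∫Φ dμ ≥ δ` has a μ-typical orbit whose
`liminf` time-mean of `Φ` is `≥ δ` (Fubini gives, for every `T`, an orbit with `∫₀ᵀ(Φ − δ) ≥ 0`; then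
`Literature.Dynamics.Ergodic.exists_orbit_integral_bounded_below`, transported to `↥S → ℂ³`). -/
theorem exists_orbit_of_invariantLaw {S : Finset ℤ³} (hS : ∀ k ∈ S, -k ∈ S) {ν : ℝ} (hν : 0 ≤ ν)
    {g : ℤ³ → ℂ³} (hg : IsConjSymm g) {μ : Measure (↥S → ℂ³)} [IsProbabilityMeasure μ]
    {K : Set (↥S → ℂ³)} (hK : IsCompact K) (hKV : K ⊆ (galerkinSubspace S : Set (↥S → ℂ³)))
    (hμK : μ Kᶜ = 0)
    (hinv : ∀ t, 0 ≤ t → μ.map (galerkinCoeffFlow ν (fun k : ↥S => g k) t) = μ)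
    {Φ : (↥S → ℂ³) → ℝ} (hΦ : Continuous Φ) {δ : ℝ} (hδ : δ ≤ ∫ x, Φ x ∂μ) :
    ∃ c₀ ∈ K, δ ≤ longTimeAvgInf (fun t => Φ (galerkinCoeffFlow ν (fun k : ↥S => g k) t c₀)) := by
  sorry

/-- **A8 (orbit ⇒ law; Krylov–Bogoliubov along a realising subsequence).** Conversely every trajectory
hands its `liminf` time-mean of a continuous `Φ` to SOME invariant law carried by the absorbing ball
(`exists_invariantMeasure_tendsto_timeAverage_semiflow` on the compact forward-invariant set
`galerkinSubspace S ∩ closedBall 0 R`).  With A7: "∃ loud bounded orbit at level `S`" ⟺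
"`max_{μ invariant} ∫Φ_λ dμ ≥ δ`" — the EXTREMAL-MEASURE currency. -/
theorem exists_invariantLaw_of_orbit {S : Finset ℤ³} (hS : ∀ k ∈ S, -k ∈ S) (h0 : (0 : ℤ³) ∉ S)
    {ν : ℝ} (hν : 0 < ν) {g : ℤ³ → ℂ³} (hg : IsConjSymm g) {c : ℝ → ↥S → ℂ³}
    (hc : IsCoeffTrajectory S ν g c) {Φ : (↥S → ℂ³) → ℝ} (hΦ : Continuous Φ) :
    ∃ μ : Measure (↥S → ℂ³), IsProbabilityMeasure μ ∧
      (∀ t, 0 ≤ t → μ.map (galerkinCoeffFlow ν (fun k : ↥S => g k) t) = μ) ∧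
      μ ((galerkinSubspace S : Set (↥S → ℂ³)) ∩ closedBall 0
        (max (Real.sqrt (coeffEnergy c 0)) (Real.sqrt (∑ k : ↥S, ‖g k‖ ^ 2) / (4 * Real.pi ^ 2 * ν))))ᶜ = 0 ∧
      longTimeAvgInf (fun t => Φ (c t)) ≤ ∫ x, Φ x ∂μ := by
  sorry

/-! ## §B  Extremal witnesses at finite `(ν, K)` (certified small cases) -/

/-- **B1 (steady witness).** A zero of the Galerkin field in the phase space is a constant trajectory whose
long-time means are its energy and dissipation (no `limsup`/`liminf` junk: constant means). -/
theorem steady_isCoeffTrajectory {S : Finset ℤ³} {ν : ℝ} {g : ℤ³ → ℂ³} {a : ↥S → ℂ³}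
    (ha : a ∈ galerkinSubspace S) (h0 : galerkinRHS S ν (fun k : ↥S => g k) a = 0) :
    IsCoeffTrajectory S ν g (fun _ => a) ∧
      longTimeAvgSup (coeffEnergy (fun _ : ℝ => a)) = ∑ k : ↥S, ‖a k‖ ^ 2 ∧
      longTimeAvgInf (coeffDissipation ν (fun _ : ℝ => a)) =
        ν * (4 * Real.pi ^ 2 * ∑ k : ↥S, freqNormSq (k : ℤ³) * ‖a k‖ ^ 2) := by
  sorry

/-- **B2 (periodic witness).** For a `τ`-periodic trajectory the two long-time means are period averages
(`longTimeAvgSup_eq_of_periodic`, `longTimeAvgInf_eq_of_periodic`, in tree). -/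
theorem periodic_longTimeAvg {S : Finset ℤ³} {ν : ℝ} {c : ℝ → ↥S → ℂ³} {τ : ℝ} (hτ : 0 < τ)
    (hper : Function.Periodic c τ) :
    longTimeAvgSup (coeffEnergy c) = τ⁻¹ * ∫ t in (0 : ℝ)..τ, coeffEnergy c t ∧
      longTimeAvgInf (coeffDissipation ν c) = τ⁻¹ * ∫ t in (0 : ℝ)..τ, coeffDissipation ν c t := by
  sorry

/-- **B3 (Krawczyk / Newton–Kantorovich certificate ⇒ exact steady state).** If the Newton-like map
`x ↦ x − A (F x)` (`A` an injective linear preconditioner) maps a closed ball into itself and contracts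
there, `F` has a zero in the ball (Banach fixed point on the complete ball).  This is the lemma a
`kit`-certified interval enclosure of a Galerkin steady state is checked against. -/
theorem exists_zero_of_newton_contracting {E : Type*} [NormedAddCommGroup E] [NormedSpace ℝ E]
    [CompleteSpace E] (F : E → E) (A : E →L[ℝ] E) (hA : Function.Injective A) (x₀ : E) {r : ℝ}
    (hr : 0 ≤ r) {κ : ℝ≥0} (hκ : κ < 1)
    (hmaps : MapsTo (fun x => x - A (F x)) (closedBall x₀ r) (closedBall x₀ r))
    (hlip : LipschitzOnWith κ (fun x => x - A (F x)) (closedBall x₀ r)) :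
    ∃ x ∈ closedBall x₀ r, F x = 0 := by
  sorry

/-! ## §C  Autopsy / tightness: what any witness must look like -/

/-- **C1 (truncation ceiling on dissipation).** On `S ⊆ freqBall K`: `D ≤ ν·4π²K²·En` pointwise. -/
theorem coeffDissipation_le_of_subset_freqBall {S : Finset ℤ³} {K : ℕ} (hSK : S ⊆ freqBall K) {ν : ℝ}
    (hν : 0 ≤ ν) (c : ℝ → ↥S → ℂ³) (t : ℝ) :
    coeffDissipation ν c t ≤ ν * (4 * Real.pi ^ 2 * (K : ℝ) ^ 2) * coeffEnergy c t := by
  sorry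

/-- **C2 (the `K₀`-uniform strengthening is FALSE).** If one truncation threshold `K₀` served every `j`,
then at `K = K₀` C1 + bounded energy force `⟨D⟩⁻ ≤ 4π²K₀²ν_j·E → 0 < ε`: the order "`∀ j, ∃ K₀`" of
the stub is load-bearing and `K₀(j)² ≥ ε / (4π²ν_j E)` (`K₀ ≳ k_η`-type growth is forced). -/
theorem not_stub_with_uniform_threshold :
    ¬ ∃ (N : ℕ) (g : ℤ³ → ℂ³), IsDesignerForce N g ∧ ∃ (E ε : ℝ), 0 < ε ∧ ∃ ν : ℕ → ℝ,
      (∀ j, 0 < ν j) ∧ Tendsto ν atTop (nhds 0) ∧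
      ∃ K₀ : ℕ, ∀ j, ∀ K, K₀ ≤ K → ∀ S : Finset ℤ³, S = (freqBall K).erase 0 →
        ∃ c : ℝ → ↥S → ℂ³, IsCoeffTrajectory S (ν j) g c ∧
          longTimeAvgSup (coeffEnergy c) ≤ E ∧ ε ≤ longTimeAvgInf (coeffDissipation (ν j) c) := by
  sorry

/-- **C3 (energy-row necessity).** Any witness of the stub at one level has `ε ≤ ‖g‖_{ℓ²}·√E`
(A4 + A5): the budgets of a witness family satisfy `ε² ≤ (Σ_{|k|≤N}‖g_k‖²)·E`. -/
theorem eps_le_of_witness {S : Finset ℤ³} (hS : ∀ k ∈ S, -k ∈ S) (h0 : (0 : ℤ³) ∉ S) {ν : ℝ}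
    (hν : 0 < ν) {g : ℤ³ → ℂ³} (hg : IsConjSymm g) {c : ℝ → ↥S → ℂ³} (hc : IsCoeffTrajectory S ν g c)
    {E ε : ℝ} (hE : longTimeAvgSup (coeffEnergy c) ≤ E) (hε : ε ≤ longTimeAvgInf (coeffDissipation ν c)) :
    ε ≤ Real.sqrt (∑ k : ↥S, ‖g k‖ ^ 2) * Real.sqrt E := by
  sorry

/-! ## §D  Perturbation from the proved neighbour: the first-order (in `ν`) transfer deficit -/

/-- Transfer out of the forcing modes `τ(t) = Σ_{k∈S} Re⟨g_k, 𝓕[(u·∇)u](k)⟩`. -/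
def coeffTransfer {S : Finset ℤ³} (g : ℤ³ → ℂ³) (c : ℝ → ↥S → ℂ³) : ℝ → ℝ :=
  fun t => ∑ k : ↥S, (inner ℂ (g k) (convectionCoeff S (coeffExt S (c t)) (coeffExt S (c t)) k)).re

/-- Single-shell force: all active modes have the same `|k|² = κ₀` (Taylor–Green `κ₀ = 3`, ABC `κ₀ = 1`). -/
def IsSingleShell (κ₀ : ℝ) (g : ℤ³ → ℂ³) : Prop :=
  ∀ k, g k ≠ 0 → freqNormSq k = κ₀

/-- **D1 (the `g`-budget).** For a transversal single-shell `g` supported in a symmetric `S`: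
`d/dt W = −ν·4π²κ₀·W + ‖g‖² − τ` (Leray symbol self-adjoint and `= id` on `g_k`, `leraySym_of_transversal`). -/
theorem hasDerivWithinAt_coeffWork {S : Finset ℤ³} (hS : ∀ k ∈ S, -k ∈ S) {ν κ₀ : ℝ} {N : ℕ}
    {g : ℤ³ → ℂ³} (hg : IsDesignerForce N g) (hshell : IsSingleShell κ₀ g)
    (hsupp : ∀ k, g k ≠ 0 → k ∈ S) {c : ℝ → ↥S → ℂ³} (hc : IsCoeffTrajectory S ν g c) (T : ℝ)
    {t : ℝ} (ht : t ∈ Set.Icc (0 : ℝ) T) :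
    HasDerivWithinAt (coeffWork g c)
      (-(ν * (4 * Real.pi ^ 2 * κ₀)) * coeffWork g c t + (∑ k : ↥S, ‖g k‖ ^ 2) - coeffTransfer g c t)
      (Set.Icc 0 T) t := by
  sorry

/-- **D2 (exact first-order identity).** Time-averaging D1 and A4 on a (bounded) trajectory:
`⟨D⟩⁻ = (‖g‖² − ⟨τ⟩⁺) / (4π²κ₀ν)` — the stub's dissipation floor `ε` IS a transfer deficit `4π²κ₀εν`,
LINEAR in `ν`; the zeroth order `⟨τ⟩⁺ ≤ ‖g‖²` is free (`⟨D⟩⁻ ≥ 0`). -/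
theorem longTimeAvgInf_coeffDissipation_eq_deficit {S : Finset ℤ³} (hS : ∀ k ∈ S, -k ∈ S)
    (h0 : (0 : ℤ³) ∉ S) {ν κ₀ : ℝ} (hν : 0 < ν) (hκ₀ : 0 < κ₀) {N : ℕ} {g : ℤ³ → ℂ³}
    (hg : IsDesignerForce N g) (hshell : IsSingleShell κ₀ g) (hsupp : ∀ k, g k ≠ 0 → k ∈ S)
    {c : ℝ → ↥S → ℂ³} (hc : IsCoeffTrajectory S ν g c) :
    longTimeAvgInf (coeffDissipation ν c) =
      ((∑ k : ↥S, ‖g k‖ ^ 2) - longTimeAvgSup (coeffTransfer g c)) / (4 * Real.pi ^ 2 * κ₀ * ν) := by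
  sorry

/-- **D3 (deficit form ⇒ the stub).** A single-shell designer force and a family of bounded trajectories,
eventually in `K`, whose mean transfer falls short of `‖g‖²` by `θ·ν_j` closes the stub with
`ε := θ / (4π²κ₀)` (D2; for `K ≥ N` the whole force shell lies in `S`). -/
theorem stub_of_transferDeficit
    (h : ∃ (N : ℕ) (g : ℤ³ → ℂ³) (κ₀ : ℝ), IsDesignerForce N g ∧ IsSingleShell κ₀ g ∧ 0 < κ₀ ∧
      ∃ (E θ : ℝ), 0 < θ ∧ ∃ ν : ℕ → ℝ, (∀ j, 0 < ν j) ∧ Tendsto ν atTop (nhds 0) ∧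
        ∀ j, ∃ K₀ : ℕ, ∀ K, K₀ ≤ K → ∀ S : Finset ℤ³, S = (freqBall K).erase 0 →
          ∃ c : ℝ → ↥S → ℂ³, IsCoeffTrajectory S (ν j) g c ∧ longTimeAvgSup (coeffEnergy c) ≤ E ∧
            longTimeAvgSup (coeffTransfer g c) ≤ (∑ k : ↥S, ‖g k‖ ^ 2) - θ * ν j) :
    Statement.stub_uniformGalerkinAnomaly := by
  sorry

end Summit.AnomalousDissipation.AnomalousDissipation.Cruxes.GalerkinFloor.Birth

end
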